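import Summits.HodgeConjecture.HodgeConjecture.Theorems.PadicSemiregularLiftFermatAnchorAssemblyStubRigidLift
import Summits.HodgeConjecture.HodgeConjecture.Theorems.PadicSemiregularLiftFermatAnchorAssemblyStubEulerBaseChange

/-!
# Rigid seeds inherit every characteristic-zero divisibility of their `⊤`-graded charge polynomial
(line `witt-lift-rigid-mf` of crux `FermatAnchorAssembly`, stmt-HodgeConjecture-14874; lead c6, STRUCTURE-c6 §3 "(R4) rigid ⟹ liftable ⟹ numerically Hodge")

Route `PadicSemiregularLift` of `HodgeConjecture`. The line's two LANDED engine theorems — the Witt lift of an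
`L`-rigid `L`-graded matrix factorization (`stub_rigidLift`, p144424) and the characteristic-zero model with the same
charge polynomial (`stub_eulerBaseChange`, p144063) — compose, after FORGETTING the grading subgroup `L` to `⊤`
(an `L`-bihomogeneous matrix is `⊤`-bihomogeneous), into the following selection rule: if `M` is `L`-rigid over the
perfect field `𝕜` of characteristic `p ∤ m`, then for every character `γ` the `⊤`-graded charge polynomial
`Θ^⊤_{γ,M} ∈ ℤ[T]` of `M` equals that of SOME lawful `⊤`-graded factorization over SOME field of characteristic `0`;
consequently any divisibility `Φₘ ∣ Θ^⊤_{γ,N}` known for ALL characteristic-zero `⊤`-graded factorizations `N` at `γ`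
(hypothesis `hV` — in print it holds whenever `γ` has full support and the eigenline `V(γ)` is not of Hodge type
`(r,r)`: Orlov 2009 Thm 2.5 + Hirzebruch–Riemann–Roch for `HMF^gr` (Polishchuk–Vaintrob 2012 Thm 1.3.1) + HKR put
`ch(N)` in `⊕ₚ H^{p,p}(X_K)`, whose `γ`-isotypic part vanishes) transfers to `M`. Contrapositively
(`not_isRigid_of_not_cyclotomic_dvd_thetaPoly_top`): an object over `𝕜` that is `⊤`-CHARGED at such a `γ` — e.g. the
Orlov image of any Tate cycle whose ℓ-adic class meets a non-`(r,r)` eigenline, such as a graph of Frobenius or its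
ruled join — is not `L`-rigid for any grading subgroup `L`. This is the idea card's selection rule (Ideas/witt-lift-rigid-mf.md,
"Why it bites" (5)) as a kernel-checked consequence of the landed stubs, modulo the single characteristic-zero input `hV`
kept as an explicit hypothesis (it needs Literature vocabulary for matrix-factorization categories that the tree does
not have yet; nothing is asserted about it here).
-/

-- `Summit.HodgeConjecture.HodgeConjecture.…` is the tree's mandated summit/problem namespace (single-problem summit).
set_option linter.dupNamespace false

noncomputable section

namespace Summit.HodgeConjecture.HodgeConjecture.Cruxes.FermatAnchorAssembly.WittLiftRigidMf

/-- Bihomogeneity is monotone in the grading subgroup: an `L`-bihomogeneous polynomial is `L'`-bihomogeneous for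
every `L ≤ L'` (less equivariance). [folklore] -/
theorem IsBihom.mono {R : Type} [CommSemiring R] {ν m : ℕ} {L L' : AddSubgroup (Fin ν → ZMod m)} (h : L ≤ L')
    {q : MvPolynomial (Fin ν) R} {d : ℤ} {c : Fin ν → ZMod m} (hq : IsBihom m L q d c) : IsBihom m L' q d c :=
  fun e he ↦ ⟨(hq e he).1, h (hq e he).2⟩

/-- **Rigid seeds inherit characteristic-zero divisibilities of their `⊤`-graded charge polynomial.** Let `𝕜` be a
perfect field of characteristic `p ∤ m` with a primitive `m`-th root of unity `ζ`, `γ` a character, and suppose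
(`hV`) that for every field `K` of characteristic `0`, every primitive `ξ ∈ K` and every lawful `⊤`-graded
factorization `N` of `Σ xᵢᵐ` over `K` one has `Φₘ ∣ Θ^⊤_{γ,N}`. Then every lawful `L`-graded factorization `M` over
`𝕜` that is `L`-RIGID has `Φₘ ∣ Θ^⊤_{γ,M}` (the `⊤`-graded charge polynomial of the same matrices). Proof: Witt lift
(`stub_rigidLift`), forget `L` to `⊤`, characteristic-zero model with the same `⊤`-theta (`stub_eulerBaseChange` at
`L = ⊤`), apply `hV`. [folklore assembly] -/
theorem cyclotomic_dvd_thetaPoly_top_of_isRigid : ∀ {p : ℕ} [Fact p.Prime] {𝕜 : Type} [Field 𝕜] [CharP 𝕜 p] [PerfectRing 𝕜 p] {ν m : ℕ} [NeZero m], ¬ p ∣ m → ∀ {ζ : 𝕜}, IsPrimitiveRoot ζ m → ∀ (γ : Fin ν → ZMod m) {ι₀ ι₁ : Type} [Fintype ι₀] [Fintype ι₁] [DecidableEq ι₀] [DecidableEq ι₁], (∀ (K : Type) [Field K] [CharZero K] (ξ : K), IsPrimitiveRoot ξ m → ∀ N : GMF K ν m ⊤ ι₀ ι₁, Polynomial.cyclotomic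 m ℤ ∣ GMFData.thetaPoly K ⊤ ξ γ N.toGMFData) → ∀ {L : AddSubgroup (Fin ν → ZMod m)} (M : GMF 𝕜 ν m L ι₀ ι₁), GMFData.IsRigid 𝕜 L M.toGMFData → Polynomial.cyclotomic m ℤ ∣ GMFData.thetaPoly 𝕜 ⊤ ζ γ M.toGMFData := by
  intro p _ 𝕜 _ _ _ ν m _ hp ζ hζ γ ι₀ ι₁ _ _ _ _ hV L M hM
  -- Witt lift of the rigid `L`-graded factorization
  obtain ⟨MW, hMW⟩ := stub_rigidLift p 𝕜 ν m ι₀ ι₁ L M hM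
  -- forget the grading subgroup: the same data is a lawful `⊤`-graded factorization over `𝕎 𝕜`
  let MW' : GMF (WittVector p 𝕜) ν m ⊤ ι₀ ι₁ :=
    { toGMFData := MW.toGMFData
      φ_bihom := fun i j ↦ (MW.φ_bihom i j).mono le_top
      ψ_bihom := fun j i ↦ (MW.ψ_bihom j i).mono le_top
      φ_mul_ψ := MW.φ_mul_ψ
      ψ_mul_φ := MW.ψ_mul_φ }
  -- characteristic-zero model with the same `⊤`-graded charge polynomial
  obtain ⟨C⟩ := stub_eulerBaseChange p 𝕜 ν m hp ζ hζ γ ι₀ ι₁ ⊤ MW'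
  letI := C.field
  haveI := C.charZero
  have h1 := hV C.K C.ζ C.prim C.N
  rw [C.theta_eq] at h1
  have h2 : MW'.toGMFData = MW.toGMFData := rfl
  rwa [h2, hMW] at h1

/-- **Selection rule (contrapositive): `⊤`-charged at a characteristic-zero-vanishing character ⟹ not rigid, for any
grading subgroup.** With `hV` as above, a lawful `L`-graded factorization `M` over `𝕜` whose `⊤`-graded charge
polynomial at `γ` is NOT divisible by `Φₘ` is not `L`-rigid. In print `hV` holds for every full-support `γ` whose
eigenline is not of middle Hodge type, and `Φₘ ∤ Θ^⊤_{γ,M}` holds for the Orlov image of any Tate cycle of the special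
fibre whose ℓ-adic class meets `V(γ)` and `V(−γ)` (graphs of Frobenius, their ruled joins, Hermitian linear subspaces):
such objects are never rigid seeds (STRUCTURE-c6 §3). [folklore assembly] -/
theorem not_isRigid_of_not_cyclotomic_dvd_thetaPoly_top
    {p : ℕ} [Fact p.Prime] {𝕜 : Type} [Field 𝕜] [CharP 𝕜 p] [PerfectRing 𝕜 p] {ν m : ℕ} [NeZero m]
    (hp : ¬ p ∣ m) {ζ : 𝕜} (hζ : IsPrimitiveRoot ζ m) (γ : Fin ν → ZMod m)
    {ι₀ ι₁ : Type} [Fintype ι₀] [Fintype ι₁] [DecidableEq ι₀] [DecidableEq ι₁]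
    (hV : ∀ (K : Type) [Field K] [CharZero K] (ξ : K), IsPrimitiveRoot ξ m →
      ∀ N : GMF K ν m ⊤ ι₀ ι₁, Polynomial.cyclotomic m ℤ ∣ GMFData.thetaPoly K ⊤ ξ γ N.toGMFData)
    {L : AddSubgroup (Fin ν → ZMod m)} (M : GMF 𝕜 ν m L ι₀ ι₁)
    (hc : ¬ (Polynomial.cyclotomic m ℤ ∣ GMFData.thetaPoly 𝕜 ⊤ ζ γ M.toGMFData)) :
    ¬ GMFData.IsRigid 𝕜 L M.toGMFData :=
  fun hM ↦ hc (cyclotomic_dvd_thetaPoly_top_of_isRigid hp hζ γ hV M hM)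

end Summit.HodgeConjecture.HodgeConjecture.Cruxes.FermatAnchorAssembly.WittLiftRigidMf

end
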